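import Summits.BirchSwinnertonDyer.BirchSwinnertonDyer.Theorems.SmallImageMuTransferAnalyticMuZeroX9Split
import HarnessLib

/-!
# Skeleton of record (BC3 shape) for the shared μ-crux `AnalyticMuZeroX9` (stmt-BirchSwinnertonDyer-19630)
— the K6 route's SPLIT D1 **BY ITEM NAME** (plan g6 of cell bsd-print-x9, 2026-08-28).

The item is wanted by `route-BirchSwinnertonDyer-SmallImageMuTransfer` (K6, rank 3; decl
`Theses.SmallImageMuTransfer.AnalyticMuZeroX9 := Rank1Residual.AnalyticMuZeroOnClassX9`) and by
`route-BirchSwinnertonDyer-PrintX9` (rank 3; `Theses.PrintX9.AnalyticMuZeroX9`, the same constant).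
Its registry skeleton was, since 2026-08-27T23:46:49Z, bsd-f3-mu's SELF-DESCRIBING WITHDRAWN text
(director ruling W-61 released LINE C `teichSpan-x9`; «⛔ … THIS IS NOT A LINE»), left in place only
because `ledger skeleton` has no withdraw verb, with the standing ask (bsd-print-x9 INBOX
2026-08-27T23:47:36Z) that this cell replace it by a skeleton of its own.

This file is that replacement.  It asserts NO new mathematics: it records, in skeleton form, the
K6 route's existing glued split D1 (gen 1, rev 4) of the crux —
`AnalyticMuZeroX9 ⟸ MuZeroCMCurves ∧ AnalyticMuZeroX9NoCMPartner ∧ MuSplitInputs` — whose glue item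
`AnalyticMuZeroX9Split` (stmt-19237) is CLOSED, proved by
`Theorems.smallImageMuTransfer_AnalyticMuZeroX9Split_proof` (p418273; seam =
`Rank1Residual.analyticMuZeroOnClassX9_of_cmSplit`, EPW 2006 Thm 1 transfer along a torsion
isomorphism to a good-ordinary CM partner + period unit + Carayol).

* `stub_muZeroCMCurves : MuZeroCMCurves` — route item stmt-BirchSwinnertonDyer-19234 BY NAME (crux r301;
  Greenberg μ = 0 for the 9 maximal-order class-number-one CM curves at every split p ≥ 5; OPEN; own K6
  skeleton `stub_translate/stub_katzFrame/stub_unitContentCycAxis`; attacked by route CycTangentCM).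
* `stub_analyticMuZeroX9NoCMPartner : AnalyticMuZeroX9NoCMPartner` — item stmt-19235 BY NAME (crux r302;
  the X9 pairs with no good-ordinary CM partner: 5S4 624/790, …; OPEN; own K6 skeleton
  `stub_dihedral_noCM/stub_exceptional_noCM`; per-ρ̄ EPW certificates only).
* `stub_muSplitInputs : MuSplitInputs` — item stmt-19236 BY NAME (support r303, cite-only conjunction:
  EPW 2006 Thm 1 ∧ period unit ∧ Carayol; HELD, never staffed).
* `AnalyticMuZeroX9_of` — the hypotheses-form composition, sorry-free, concluding the local alias `CruxGoal`;
  `AnalyticMuZeroX9_of_stubs` — the ONLY theorem concluding the crux decl by name (HarnessLib skeleton audit).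

Each stub is a route item, so a proof of any of them lands against the ITEM (K6 route), not against this file.
-/

set_option linter.dupNamespace false

namespace Summit.BirchSwinnertonDyer.BirchSwinnertonDyer.Cruxes.AnalyticMuZeroX9.CMPartnerSplit

open Summit.BirchSwinnertonDyer.BirchSwinnertonDyer.Theses.SmallImageMuTransfer

/-- stub 1 = route item stmt-BirchSwinnertonDyer-19234 BY NAME (crux r301 of SmallImageMuTransfer). OPEN. -/
theorem stub_muZeroCMCurves : MuZeroCMCurves := by
  sorry

/-- stub 2 = route item stmt-BirchSwinnertonDyer-19235 BY NAME (crux r302 of SmallImageMuTransfer). OPEN. -/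
theorem stub_analyticMuZeroX9NoCMPartner : AnalyticMuZeroX9NoCMPartner := by
  sorry

/-- stub 3 = route item stmt-BirchSwinnertonDyer-19236 BY NAME (support r303, cite-only named facts; HELD). -/
theorem stub_muSplitInputs : MuSplitInputs := by
  sorry

/-- Local alias of the crux constant, so that exactly ONE theorem below (`AnalyticMuZeroX9_of_stubs`)
concludes the crux decl by name. -/
def CruxGoal : Prop :=
  Summit.BirchSwinnertonDyer.BirchSwinnertonDyer.Theses.SmallImageMuTransfer.AnalyticMuZeroX9

/-- Composition (sorry-free): the K6 split glue, proved item stmt-19237. -/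
theorem AnalyticMuZeroX9_of (h₁ : MuZeroCMCurves) (h₂ : AnalyticMuZeroX9NoCMPartner)
    (h₃ : MuSplitInputs) : CruxGoal :=
  Summit.BirchSwinnertonDyer.BirchSwinnertonDyer.Theorems.smallImageMuTransfer_AnalyticMuZeroX9Split_proof
    h₁ h₂ h₃

/-- The crux BY NAME from the three registered stubs (the only theorem concluding the crux decl). -/
theorem AnalyticMuZeroX9_of_stubs :
    Summit.BirchSwinnertonDyer.BirchSwinnertonDyer.Theses.SmallImageMuTransfer.AnalyticMuZeroX9 :=
  AnalyticMuZeroX9_of stub_muZeroCMCurves stub_analyticMuZeroX9NoCMPartner stub_muSplitInputs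

/-- Sanity: the PrintX9 route's decl of the same item is the same constant (dedup by signature). -/
example :
    Summit.BirchSwinnertonDyer.BirchSwinnertonDyer.Theses.SmallImageMuTransfer.AnalyticMuZeroX9 =
      Summit.BirchSwinnertonDyer.BirchSwinnertonDyer.Rank1Residual.AnalyticMuZeroOnClassX9 :=
  rfl

end Summit.BirchSwinnertonDyer.BirchSwinnertonDyer.Cruxes.AnalyticMuZeroX9.CMPartnerSplit
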